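import Mathlib
import HarnessLib
import Summits.HubbardSuperconductivity.HubbardSuperconductivity.Theorems.KLProgrammeKLRegimeEngineTowerInstUVLev

/-!
# Route `KLProgramme` — crux K3 ENGINE (stmt-HubbardSuperconductivity-20437 `KLRegimeEngineV17F2`), stub (b) v2, THE LEVELS PACKAGE (ℓ), instantiation (I2)/(I3):
# THE MEASURED PROFILE OF BLOCK ZERO (the UV input `𝒱_0[K]` itself) from `KernelNormsLevels … K 0` (cell gate-hubbard-kl, seat p4 g18)

The profile rows `klTowerMuLev_le_profileR[_of_levelZero]` (…InstProfileLevRate) serve the kit's `hprof` at the blocks `k ≥ 1` (input `𝒱_{dk}` re-measured at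
`F_{dk−1}`).  At block `k = 0` the input is the UV action at the family `F_{d·0−1} = F_0` — no re-measurement, no rate: its measured levelled array is the level-zero
datum itself.  From `KernelNormsLevels L M P Qe β U μ K 0` (`0 ≤ Qe.CE`), with `ε_x = imagTimeWeight β M`, `ε₀ = epsCoupling P U 0 ≤ λ`:

* `klTowerMuLevAt_blockZero_le` — `klTowerMuLevAt … d t 0 m ≤ 27⁵·ε_x·λ^{m−1}·(Qe.CE/ε_x²)^m` (`m ≥ 3`, every track);
* **`klTowerMuLev_blockZero_le`** — the same for the track-blind `klTowerMuLev … d 0 m`.  So the kit's `hprof`/`hprof3` at `k = 0` hold with any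
  `A′ ≥ 27⁵ε_x`, `Q′ ≥ Qe.CE/ε_x²` (the assembly takes `max` with the `k ≥ 1` constants; `Q ≥ 4·Qe.CE/ε_x²` keeps `4Q′ ≤ Q`).
Compositions of landed theorems; nothing about the model is asserted beyond them; nothing asserts (ℓ), any stub, K3 or superconductivity.
References: BGM 2006 Lemma 2.5 (2.98) [cite: BenfattoGiulianiMastropietro2006].
-/

noncomputable section

namespace Summit.HubbardSuperconductivity.HubbardSuperconductivity.Theorems.EngineV8

set_option linter.dupNamespace false -- summit = problem name (single-conjunct summit), D-0017

open Classical
open Real Finset Literature.MathematicalPhysics.QuantumLattice Literature.Probability.LatticeModels GrassmannAlgebra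
open Literature.MathematicalPhysics.QuantumLattice.FermiRG
open Summit.HubbardSuperconductivity.HubbardSuperconductivity.Theorems.KLProgrammeLegKernels
open Summit.HubbardSuperconductivity.HubbardSuperconductivity.Theorems.KLRegimeSplit

variable {L M : ℕ} [NeZero L] [NeZero M]

/-- **The per-track measured array of block `0` from the level-zero package**: `klTowerMuLevAt … d t 0 m ≤ 27⁵·ε_x·λ^{m−1}·(Qe.CE/ε_x²)^m` for `m ≥ 3`,
`KernelNormsLevels … K 0`, `0 ≤ Qe.CE`, `epsCoupling P U 0 ≤ λ`, `0 < β`. [cite: BenfattoGiulianiMastropietro2006, Lemma 2.5 (2.98)] -/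
theorem klTowerMuLevAt_blockZero_le {P : SplitConsts} {Qe : EngConsts} {β U μ : ℝ} {K : TrigPolyC4v} (hβ : 0 < β) (hP : P.WF)
    (h0 : KernelNormsLevels L M P Qe β U μ K 0) (hCE : 0 ≤ Qe.CE) {lam : ℝ} (hεl : epsCoupling P U 0 ≤ lam) (d : ℕ) (t : Fin 5) {m : ℕ} (hm : 3 ≤ m) :
    klTowerMuLevAt L M β U μ K d t 0 m ≤ (27 : ℝ) ^ 5 * imagTimeWeight β M * lam ^ (m - 1) * (Qe.CE / imagTimeWeight β M ^ 2) ^ m := by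
  have hK0 : 0 ≤ P.Klam := le_trans zero_le_one hP.1
  have hε0 : 0 ≤ epsCoupling P U 0 := by unfold epsCoupling; positivity
  have hx : 0 < imagTimeWeight β M := by
    unfold imagTimeWeight
    have : (0 : ℝ) < M := Nat.cast_pos.2 (Nat.pos_of_ne_zero (NeZero.ne M))
    positivity
  have ht4 : (t : ℕ) ≤ 4 := by have := t.isLt; omega
  have h27 : (27 : ℝ) ^ ((t : ℕ) + 1) ≤ 27 ^ 5 := pow_le_pow_right₀ (by norm_num) (by omega)
  have hu : 0 < klLevUnit β M t m (d * 0 - 1) := klLevUnit_pos hβ t m _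
  have hmeas : klTowerMeasLev L M β U μ K d 0 (2 * m) ((t : ℕ) + 1) ≤ Qe.CE ^ m * epsCoupling P U 0 ^ (m - 1) :=
    klTowerMeasLev_zero_le_of_kernelNormsLevels h0 hCE hε0 d hm _
  have huv : Qe.CE ^ m * epsCoupling P U 0 ^ (m - 1) / klLevUnit β M t m 0 ≤
      imagTimeWeight β M * lam ^ (m - 1) * (Qe.CE / imagTimeWeight β M ^ 2) ^ m :=
    uvLaw_div_klLevUnit_zero_le hβ hCE hε0 hεl t (by omega)
  have hJ0 : d * 0 - 1 = 0 := by simp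
  unfold klTowerMuLevAt
  rw [hJ0] at hu ⊢
  rw [div_le_iff₀ hu]
  have hR0 : 0 ≤ imagTimeWeight β M * lam ^ (m - 1) * (Qe.CE / imagTimeWeight β M ^ 2) ^ m := by
    have : 0 ≤ lam := hε0.trans hεl
    positivity
  have hmeas' : klTowerMeasLev L M β U μ K d 0 (2 * m) ((t : ℕ) + 1) ≤
      imagTimeWeight β M * lam ^ (m - 1) * (Qe.CE / imagTimeWeight β M ^ 2) ^ m * klLevUnit β M t m 0 := by
    rw [div_le_iff₀ (klLevUnit_pos hβ t m 0)] at huv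
    exact hmeas.trans huv
  calc (27 : ℝ) ^ ((t : ℕ) + 1) * klTowerMeasLev L M β U μ K d 0 (2 * m) ((t : ℕ) + 1)
      ≤ 27 ^ 5 * (imagTimeWeight β M * lam ^ (m - 1) * (Qe.CE / imagTimeWeight β M ^ 2) ^ m * klLevUnit β M t m 0) :=
        mul_le_mul h27 hmeas' (klTowerMeasLev_nonneg hβ.le U μ K d 0 _ _) (by positivity)
    _ = (27 : ℝ) ^ 5 * imagTimeWeight β M * lam ^ (m - 1) * (Qe.CE / imagTimeWeight β M ^ 2) ^ m * klLevUnit β M t m 0 := by ring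

/-- **The track-blind measured array of block `0`**: `klTowerMuLev … d 0 m ≤ 27⁵·ε_x·λ^{m−1}·(Qe.CE/ε_x²)^m` (`m ≥ 3`): the kit's `hprof`/`hprof3` at `k = 0`.
[cite: BenfattoGiulianiMastropietro2006, Lemma 2.5 (2.98)] -/
theorem klTowerMuLev_blockZero_le {P : SplitConsts} {Qe : EngConsts} {β U μ : ℝ} {K : TrigPolyC4v} (hβ : 0 < β) (hP : P.WF)
    (h0 : KernelNormsLevels L M P Qe β U μ K 0) (hCE : 0 ≤ Qe.CE) {lam : ℝ} (hεl : epsCoupling P U 0 ≤ lam) (d : ℕ) {m : ℕ} (hm : 3 ≤ m) :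
    klTowerMuLev L M β U μ K d 0 m ≤ (27 : ℝ) ^ 5 * imagTimeWeight β M * lam ^ (m - 1) * (Qe.CE / imagTimeWeight β M ^ 2) ^ m := by
  obtain ⟨t, ht⟩ := exists_klTowerMuLev_eq (L := L) (M := M) β U μ K d 0 m
  rw [ht]
  exact klTowerMuLevAt_blockZero_le hβ hP h0 hCE hεl d t hm

end Summit.HubbardSuperconductivity.HubbardSuperconductivity.Theorems.EngineV8

end
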